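import Mathlib.Analysis.Convex.Deriv
import Mathlib.Analysis.Calculus.Deriv.Pow
import Mathlib.Analysis.Calculus.Deriv.Mul
import Mathlib.Analysis.Calculus.Deriv.Inv
import Mathlib.Analysis.Calculus.Deriv.Add
import Mathlib.Tactic
import HarnessLib

/-!
# The super-terminal quartic region is CONVEX in normal form: chord inequality along segments and the two-state mixture lemma

Support file for crux `stmt-CriticalPhenomena-4575` (`NoHeavyLowerTail`), seat `prim-facecert` gen 22 (`--supports stmt-CriticalPhenomena-4575`);
memo `run/shared/lean/prim/prim-l12/prim-facecert/FINDING-gen22-PENDANT-PORT-TREE-CLASS.md` §5.  No definitions, no sorries, standard axioms.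

In the normal form of the lane (`u = P(c∼S | F)`, `v = P(c∼b | F)`, `w = P(c∼T)`; lead g128) the super-terminal quartic law `V4 : Q⁴ ≤ A²B²C`
reads `w ≤ 1 − h(u,v)` with `h(u,v) = (1−u−v)⁴/((1−u)(1−v))² = Q⁴/(A²B²)`.  THIS FILE: `h` is convex along every segment of the triangle
`{u,v ≥ 0, u+v ≤ 1}`, so the `V4` region `{(u,v,w)}` is CONVEX.  In homogeneous coordinates a segment is `t ↦ N(t)⁴/(D₁(t)²D₂(t)²)` with
`N, D₁, D₂` affine, `N ≤ D₁, D₂`, `N′ = D₁′ + D₂′`; its second derivative is `N²·Br/(D₁⁴D₂⁴)` where the bracket `Br` is a positive-semidefinite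
quadratic form in `(D₁′, D₂′)`: `α·Br = (α D₁′ + β D₂′)² + 4D₁²D₂²·E·D₂′²` with `α = 2D₂²(6D₁² − 8ND₁ + 3N²) > 0` and
`E = 2N²(D₂−D₁)² + N²[5(D₁−N)(D₂−N) + 3(D₁−N)D₂ + 3(D₂−N)D₁ + D₁D₂] ≥ 0` (`bracket_nonneg`).
* `hasDerivAt_phi`, `hasDerivAt_phi'` — the two derivatives in closed form; `convexOn_phi` — convexity on `[0,1]` (Mathlib `convexOn_of_deriv2_nonneg`);
  `chord_le` — the two-point Jensen inequality.
* `quartic_of_twoStates` — **MIXTURE LEMMA**: two port states `(Fₖ,Qₖ,Aₖ,Bₖ,Cₖ)` (`0 ≤ Qₖ ≤ Aₖ,Bₖ`, `Aₖ+Bₖ = Fₖ+Qₖ`, `Cₖ ≥ 0`) satisfying `V4`,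
  with `F₀ ≤ F₁` and `C₁ ≤ C₀`, have all their mixtures `(1−ρ)·state₀ + ρ·state₁` satisfying `V4`: in normal form the mixture is the convex combination
  with the `F`-TILTED weight `t = ρF₁/F̄ ≥ ρ`, `chord_le` gives `Q⁴/(A²B²) ≤ (1−t)C₀ + tC₁ ≤ (1−ρ)C₀ + ρC₁`.
Consequences (`…SuperTerminalQuarticSegment`): for ANY pair `f` with `∂μ(F)/∂w_f ≥ 0`, `V4(w[f↦0]) ∧ V4(w[f↦1]) ⟹ V4(w)`; the pendant-port lemma
(`…SuperTerminalQuarticPendant`) is the special case of an isolated state.  (The general mixture principle — `V4 ⟸` pointwise `V4` given any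
conditioning `Z` with `Cov(P(F|Z), P(c∼T|Z)) ≥ 0` — and why it does not close `V4` alone (the port-cube corner condition fails at W99-type weights)
are in the memo §5–§7.)
-/

namespace Summit.CriticalPhenomena.PercolationContinuityZ3.Theorems.SuperTerminalQuarticChord

open Set Filter Topology

/-! ## The bracket: sign of the second derivative -/

/-- The second-derivative bracket is a positive-semidefinite quadratic form in `(dY, dZ)` when `0 ≤ N ≤ D₁, D₂`:
`α·Br = (α·dY + β·dZ)² + (αγ − β²)·dZ²` with `α = 2D₂²(6D₁² − 8ND₁ + 3N²) > 0` and `αγ − β² = 4D₁²D₂²·E`, `E ≥ 0` explicitly. [this work] -/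
theorem bracket_nonneg {N D₁ D₂ dY dZ : ℝ} (h1 : N ≤ D₁) (h2 : N ≤ D₂) (hD1 : 0 < D₁) (hD2 : 0 < D₂) :
    0 ≤ 12 * (dY + dZ) ^ 2 * D₁ ^ 2 * D₂ ^ 2 + 6 * dY ^ 2 * N ^ 2 * D₂ ^ 2 + 6 * dZ ^ 2 * N ^ 2 * D₁ ^ 2
      - 16 * (dY + dZ) * dY * N * D₁ * D₂ ^ 2 - 16 * (dY + dZ) * dZ * N * D₁ ^ 2 * D₂ + 8 * dY * dZ * N ^ 2 * D₁ * D₂ := by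
  set α : ℝ := 2 * D₂ ^ 2 * (6 * D₁ ^ 2 - 8 * N * D₁ + 3 * N ^ 2) with hα
  set β : ℝ := 4 * D₁ * D₂ * (3 * D₁ * D₂ - 2 * N * (D₁ + D₂) + N ^ 2) with hβ
  set E : ℝ := 2 * N ^ 2 * (D₂ - D₁) ^ 2 + N ^ 2 * (5 * (D₁ - N) * (D₂ - N) + 3 * (D₁ - N) * D₂ + 3 * (D₂ - N) * D₁ + D₁ * D₂) with hE
  have hq : 0 < 6 * D₁ ^ 2 - 8 * N * D₁ + 3 * N ^ 2 := by nlinarith [sq_nonneg (D₁ - 2 / 3 * N), sq_nonneg N, hD1]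
  have hαpos : 0 < α := by rw [hα]; positivity
  have hE0 : 0 ≤ E := by
    rw [hE]
    have : 0 ≤ 5 * (D₁ - N) * (D₂ - N) + 3 * (D₁ - N) * D₂ + 3 * (D₂ - N) * D₁ + D₁ * D₂ := by
      have h1' : 0 ≤ D₁ - N := by linarith
      have h2' : 0 ≤ D₂ - N := by linarith
      positivity
    positivity
  have key : α * (12 * (dY + dZ) ^ 2 * D₁ ^ 2 * D₂ ^ 2 + 6 * dY ^ 2 * N ^ 2 * D₂ ^ 2 + 6 * dZ ^ 2 * N ^ 2 * D₁ ^ 2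
      - 16 * (dY + dZ) * dY * N * D₁ * D₂ ^ 2 - 16 * (dY + dZ) * dZ * N * D₁ ^ 2 * D₂ + 8 * dY * dZ * N ^ 2 * D₁ * D₂) =
      (α * dY + β * dZ) ^ 2 + 4 * D₁ ^ 2 * D₂ ^ 2 * E * dZ ^ 2 := by
    rw [hα, hβ, hE]; ring
  have hrhs : 0 ≤ (α * dY + β * dZ) ^ 2 + 4 * D₁ ^ 2 * D₂ ^ 2 * E * dZ ^ 2 := by positivity
  rw [← key] at hrhs
  by_contra hneg
  push Not at hneg
  have := mul_neg_of_pos_of_neg hαpos hneg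
  linarith

/-! ## The segment function `φ(t) = N(t)⁴/(D₁(t)²D₂(t)²)` with `N, D₁, D₂` affine: first and second derivative -/

/-- Derivative of an affine function. [folklore] -/
theorem hasDerivAt_affine (A d t : ℝ) : HasDerivAt (fun t : ℝ => A + t * d) d t := by
  have h := ((hasDerivAt_id t).mul_const d).const_add A
  simpa using h

/-- First derivative of `φ`. [this work] -/
theorem hasDerivAt_phi (X₀ dX Y₀ dY Z₀ dZ t : ℝ) (hD1 : Y₀ + t * dY ≠ 0) (hD2 : Z₀ + t * dZ ≠ 0) :
    HasDerivAt (fun t : ℝ => (X₀ + t * dX) ^ 4 / ((Y₀ + t * dY) ^ 2 * (Z₀ + t * dZ) ^ 2))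
      ((4 * dX * (X₀ + t * dX) ^ 3 * (Y₀ + t * dY) * (Z₀ + t * dZ)
        - 2 * (X₀ + t * dX) ^ 4 * (dY * (Z₀ + t * dZ) + dZ * (Y₀ + t * dY))) / ((Y₀ + t * dY) ^ 3 * (Z₀ + t * dZ) ^ 3)) t := by
  have hN := HasDerivAt.fun_pow (hasDerivAt_affine X₀ dX t) 4
  have hD := HasDerivAt.fun_mul (HasDerivAt.fun_pow (hasDerivAt_affine Y₀ dY t) 2) (HasDerivAt.fun_pow (hasDerivAt_affine Z₀ dZ t) 2)
  have hne : (Y₀ + t * dY) ^ 2 * (Z₀ + t * dZ) ^ 2 ≠ 0 := mul_ne_zero (pow_ne_zero _ hD1) (pow_ne_zero _ hD2)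
  have h := HasDerivAt.fun_div hN hD hne
  refine h.congr_deriv ?_
  norm_num
  field_simp

/-- Second derivative of `φ`: the derivative of `φ′` is `N²·Br/(D₁⁴D₂⁴)` with `Br` the bracket of `bracket_nonneg`. [this work] -/
theorem hasDerivAt_phi' (X₀ dX Y₀ dY Z₀ dZ t : ℝ) (hD1 : Y₀ + t * dY ≠ 0) (hD2 : Z₀ + t * dZ ≠ 0) :
    HasDerivAt (fun t : ℝ => (4 * dX * (X₀ + t * dX) ^ 3 * (Y₀ + t * dY) * (Z₀ + t * dZ)
        - 2 * (X₀ + t * dX) ^ 4 * (dY * (Z₀ + t * dZ) + dZ * (Y₀ + t * dY))) / ((Y₀ + t * dY) ^ 3 * (Z₀ + t * dZ) ^ 3))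
      ((X₀ + t * dX) ^ 2 * (12 * dX ^ 2 * (Y₀ + t * dY) ^ 2 * (Z₀ + t * dZ) ^ 2
          + 6 * dY ^ 2 * (X₀ + t * dX) ^ 2 * (Z₀ + t * dZ) ^ 2 + 6 * dZ ^ 2 * (X₀ + t * dX) ^ 2 * (Y₀ + t * dY) ^ 2
          - 16 * dX * dY * (X₀ + t * dX) * (Y₀ + t * dY) * (Z₀ + t * dZ) ^ 2
          - 16 * dX * dZ * (X₀ + t * dX) * (Y₀ + t * dY) ^ 2 * (Z₀ + t * dZ)
          + 8 * dY * dZ * (X₀ + t * dX) ^ 2 * (Y₀ + t * dY) * (Z₀ + t * dZ)) / ((Y₀ + t * dY) ^ 4 * (Z₀ + t * dZ) ^ 4)) t := by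
  have hN3 := HasDerivAt.fun_pow (hasDerivAt_affine X₀ dX t) 3
  have hN4 := HasDerivAt.fun_pow (hasDerivAt_affine X₀ dX t) 4
  have hD1' := hasDerivAt_affine Y₀ dY t
  have hD2' := hasDerivAt_affine Z₀ dZ t
  have h1 := HasDerivAt.fun_mul (HasDerivAt.fun_mul (HasDerivAt.const_mul (4 * dX) hN3) hD1') hD2'
  have h2 := HasDerivAt.fun_mul (HasDerivAt.const_mul 2 hN4) (HasDerivAt.fun_add (HasDerivAt.const_mul dY hD2') (HasDerivAt.const_mul dZ hD1'))
  have hnum := HasDerivAt.fun_sub h1 h2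
  have hden := HasDerivAt.fun_mul (HasDerivAt.fun_pow hD1' 3) (HasDerivAt.fun_pow hD2' 3)
  have hne : (Y₀ + t * dY) ^ 3 * (Z₀ + t * dZ) ^ 3 ≠ 0 := mul_ne_zero (pow_ne_zero _ hD1) (pow_ne_zero _ hD2)
  have h := HasDerivAt.fun_div hnum hden hne
  refine h.congr_deriv ?_
  norm_num
  field_simp
  ring

/-! ## Convexity of `φ` on `[0,1]` and the chord inequality -/

/-- An affine interpolation of two positive numbers is positive on `[0,1]`. [folklore] -/
theorem affine_pos {A B s : ℝ} (hA : 0 < A) (hB : 0 < B) (hs0 : 0 ≤ s) (hs1 : s ≤ 1) : 0 < A + s * (B - A) := by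
  rcases le_or_gt s (1 / 2) with h | h
  · nlinarith [mul_nonneg hs0 hB.le]
  · nlinarith [mul_nonneg (sub_nonneg.2 hs1) hA.le]

/-- An affine interpolation of two nonnegative numbers is nonnegative on `[0,1]`. [folklore] -/
theorem affine_nonneg {A B s : ℝ} (hA : 0 ≤ A) (hB : 0 ≤ B) (hs0 : 0 ≤ s) (hs1 : s ≤ 1) : 0 ≤ A + s * (B - A) := by
  nlinarith [mul_nonneg hs0 hB, mul_nonneg (sub_nonneg.2 hs1) hA]

/-- Affine interpolation is monotone in the endpoints on `[0,1]`. [folklore] -/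
theorem affine_le {A B A' B' s : ℝ} (hA : A ≤ A') (hB : B ≤ B') (hs0 : 0 ≤ s) (hs1 : s ≤ 1) :
    A + s * (B - A) ≤ A' + s * (B' - A') := by
  nlinarith [mul_nonneg hs0 (sub_nonneg.2 hB), mul_nonneg (sub_nonneg.2 hs1) (sub_nonneg.2 hA)]

/-- **Convexity of the quartic ratio along a segment.**  For two admissible triples `(Xᵢ, Yᵢ, Zᵢ)` (`Xᵢ ≤ Yᵢ, Zᵢ`, `Yᵢ, Zᵢ > 0`)
with the SAME defect `Xᵢ − Yᵢ − Zᵢ` (so that `N′ = D₁′ + D₂′` along the segment), the function `t ↦ N(t)⁴/(D₁(t)²D₂(t)²)` of the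
affine interpolations is convex on `[0,1]` (second derivative `= N²·Br/(D₁⁴D₂⁴) ≥ 0`, `bracket_nonneg`). [this work] -/
theorem convexOn_phi (X₀ Y₀ Z₀ X₁ Y₁ Z₁ : ℝ) (hXY0 : X₀ ≤ Y₀) (hXZ0 : X₀ ≤ Z₀)
    (hXY1 : X₁ ≤ Y₁) (hXZ1 : X₁ ≤ Z₁) (hY0 : 0 < Y₀) (hZ0 : 0 < Z₀) (hY1 : 0 < Y₁) (hZ1 : 0 < Z₁)
    (hcons : X₁ - X₀ = (Y₁ - Y₀) + (Z₁ - Z₀)) :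
    ConvexOn ℝ (Icc (0:ℝ) 1)
      (fun t : ℝ => (X₀ + t * (X₁ - X₀)) ^ 4 / ((Y₀ + t * (Y₁ - Y₀)) ^ 2 * (Z₀ + t * (Z₁ - Z₀)) ^ 2)) := by
  set dX := X₁ - X₀ with hdX
  set dY := Y₁ - Y₀ with hdY
  set dZ := Z₁ - Z₀ with hdZ
  -- positivity of the denominators on `[0,1]`, and `0 ≤ N ≤ D₁, D₂` there
  have D1pos : ∀ s ∈ Icc (0:ℝ) 1, 0 < Y₀ + s * dY := fun s hs => affine_pos hY0 hY1 hs.1 hs.2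
  have D2pos : ∀ s ∈ Icc (0:ℝ) 1, 0 < Z₀ + s * dZ := fun s hs => affine_pos hZ0 hZ1 hs.1 hs.2
  have Nle1 : ∀ s ∈ Icc (0:ℝ) 1, X₀ + s * dX ≤ Y₀ + s * dY := fun s hs => affine_le hXY0 hXY1 hs.1 hs.2
  have Nle2 : ∀ s ∈ Icc (0:ℝ) 1, X₀ + s * dX ≤ Z₀ + s * dZ := fun s hs => affine_le hXZ0 hXZ1 hs.1 hs.2
  -- the first derivative on the open interval
  have hder : ∀ s ∈ Ioo (0:ℝ) 1, HasDerivAt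
      (fun t : ℝ => (X₀ + t * dX) ^ 4 / ((Y₀ + t * dY) ^ 2 * (Z₀ + t * dZ) ^ 2))
      ((4 * dX * (X₀ + s * dX) ^ 3 * (Y₀ + s * dY) * (Z₀ + s * dZ)
        - 2 * (X₀ + s * dX) ^ 4 * (dY * (Z₀ + s * dZ) + dZ * (Y₀ + s * dY))) / ((Y₀ + s * dY) ^ 3 * (Z₀ + s * dZ) ^ 3)) s :=
    fun s hs => hasDerivAt_phi X₀ dX Y₀ dY Z₀ dZ s (ne_of_gt (D1pos s (Ioo_subset_Icc_self hs)))
      (ne_of_gt (D2pos s (Ioo_subset_Icc_self hs)))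
  have hderiv_eq : ∀ s ∈ Ioo (0:ℝ) 1, deriv
      (fun t : ℝ => (X₀ + t * dX) ^ 4 / ((Y₀ + t * dY) ^ 2 * (Z₀ + t * dZ) ^ 2)) =ᶠ[𝓝 s]
      (fun t : ℝ => (4 * dX * (X₀ + t * dX) ^ 3 * (Y₀ + t * dY) * (Z₀ + t * dZ)
        - 2 * (X₀ + t * dX) ^ 4 * (dY * (Z₀ + t * dZ) + dZ * (Y₀ + t * dY))) / ((Y₀ + t * dY) ^ 3 * (Z₀ + t * dZ) ^ 3)) :=
    fun s hs => Filter.eventuallyEq_of_mem (Ioo_mem_nhds hs.1 hs.2) fun y hy => (hder y hy).deriv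
  -- the second derivative on the open interval
  have hder2 : ∀ s ∈ Ioo (0:ℝ) 1, HasDerivAt
      (deriv (fun t : ℝ => (X₀ + t * dX) ^ 4 / ((Y₀ + t * dY) ^ 2 * (Z₀ + t * dZ) ^ 2)))
      ((X₀ + s * dX) ^ 2 * (12 * dX ^ 2 * (Y₀ + s * dY) ^ 2 * (Z₀ + s * dZ) ^ 2
          + 6 * dY ^ 2 * (X₀ + s * dX) ^ 2 * (Z₀ + s * dZ) ^ 2 + 6 * dZ ^ 2 * (X₀ + s * dX) ^ 2 * (Y₀ + s * dY) ^ 2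
          - 16 * dX * dY * (X₀ + s * dX) * (Y₀ + s * dY) * (Z₀ + s * dZ) ^ 2
          - 16 * dX * dZ * (X₀ + s * dX) * (Y₀ + s * dY) ^ 2 * (Z₀ + s * dZ)
          + 8 * dY * dZ * (X₀ + s * dX) ^ 2 * (Y₀ + s * dY) * (Z₀ + s * dZ)) / ((Y₀ + s * dY) ^ 4 * (Z₀ + s * dZ) ^ 4)) s :=
    fun s hs => (hasDerivAt_phi' X₀ dX Y₀ dY Z₀ dZ s (ne_of_gt (D1pos s (Ioo_subset_Icc_self hs)))
      (ne_of_gt (D2pos s (Ioo_subset_Icc_self hs)))).congr_of_eventuallyEq (hderiv_eq s hs)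
  refine convexOn_of_deriv2_nonneg (convex_Icc 0 1) ?_ ?_ ?_ ?_
  · refine ContinuousOn.div (Continuous.continuousOn (by fun_prop)) (Continuous.continuousOn (by fun_prop)) ?_
    intro s hs
    exact mul_ne_zero (pow_ne_zero _ (ne_of_gt (D1pos s hs))) (pow_ne_zero _ (ne_of_gt (D2pos s hs)))
  · rw [interior_Icc]
    exact fun s hs => (hder s hs).differentiableAt.differentiableWithinAt
  · rw [interior_Icc]
    exact fun s hs => (hder2 s hs).differentiableAt.differentiableWithinAt
  · rw [interior_Icc]
    intro s hs
    have hs' : s ∈ Icc (0:ℝ) 1 := Ioo_subset_Icc_self hs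
    have e2 : deriv^[2] (fun t : ℝ => (X₀ + t * dX) ^ 4 / ((Y₀ + t * dY) ^ 2 * (Z₀ + t * dZ) ^ 2)) s =
        (X₀ + s * dX) ^ 2 * (12 * dX ^ 2 * (Y₀ + s * dY) ^ 2 * (Z₀ + s * dZ) ^ 2
          + 6 * dY ^ 2 * (X₀ + s * dX) ^ 2 * (Z₀ + s * dZ) ^ 2 + 6 * dZ ^ 2 * (X₀ + s * dX) ^ 2 * (Y₀ + s * dY) ^ 2
          - 16 * dX * dY * (X₀ + s * dX) * (Y₀ + s * dY) * (Z₀ + s * dZ) ^ 2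
          - 16 * dX * dZ * (X₀ + s * dX) * (Y₀ + s * dY) ^ 2 * (Z₀ + s * dZ)
          + 8 * dY * dZ * (X₀ + s * dX) ^ 2 * (Y₀ + s * dY) * (Z₀ + s * dZ)) / ((Y₀ + s * dY) ^ 4 * (Z₀ + s * dZ) ^ 4) := by
      simp only [Function.iterate_succ, Function.iterate_zero, Function.comp_apply, id_eq]
      exact (hder2 s hs).deriv
    rw [e2]
    have hdXeq : dX = dY + dZ := by rw [hdX, hdY, hdZ]; linarith
    have hbr := bracket_nonneg (N := X₀ + s * dX) (dY := dY) (dZ := dZ) (Nle1 s hs') (Nle2 s hs') (D1pos s hs') (D2pos s hs')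
    rw [← hdXeq] at hbr
    apply div_nonneg _ (by positivity)
    apply mul_nonneg (sq_nonneg _)
    nlinarith [hbr]

/-- **Chord inequality** (the two-point Jensen form used by the mixture lemma): under the hypotheses of `convexOn_phi`,
`φ(t) ≤ (1−t)·φ(0) + t·φ(1)` for `t ∈ [0,1]`. [this work] -/
theorem chord_le (X₀ Y₀ Z₀ X₁ Y₁ Z₁ : ℝ) (hXY0 : X₀ ≤ Y₀) (hXZ0 : X₀ ≤ Z₀)
    (hXY1 : X₁ ≤ Y₁) (hXZ1 : X₁ ≤ Z₁) (hY0 : 0 < Y₀) (hZ0 : 0 < Z₀) (hY1 : 0 < Y₁) (hZ1 : 0 < Z₁)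
    (hcons : X₁ - X₀ = (Y₁ - Y₀) + (Z₁ - Z₀)) {t : ℝ} (ht0 : 0 ≤ t) (ht1 : t ≤ 1) :
    (X₀ + t * (X₁ - X₀)) ^ 4 / ((Y₀ + t * (Y₁ - Y₀)) ^ 2 * (Z₀ + t * (Z₁ - Z₀)) ^ 2) ≤
      (1 - t) * (X₀ ^ 4 / (Y₀ ^ 2 * Z₀ ^ 2)) + t * (X₁ ^ 4 / (Y₁ ^ 2 * Z₁ ^ 2)) := by
  have hc := convexOn_phi X₀ Y₀ Z₀ X₁ Y₁ Z₁ hXY0 hXZ0 hXY1 hXZ1 hY0 hZ0 hY1 hZ1 hcons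
  set φ : ℝ → ℝ := fun t : ℝ => (X₀ + t * (X₁ - X₀)) ^ 4 / ((Y₀ + t * (Y₁ - Y₀)) ^ 2 * (Z₀ + t * (Z₁ - Z₀)) ^ 2) with hφ
  have h := hc.2 (show (0:ℝ) ∈ Icc (0:ℝ) 1 by simp) (show (1:ℝ) ∈ Icc (0:ℝ) 1 by simp)
    (show 0 ≤ 1 - t by linarith) ht0 (show (1 - t) + t = 1 by ring)
  have et : (1 - t) • (0:ℝ) + t • (1:ℝ) = t := by simp
  rw [et, smul_eq_mul, smul_eq_mul] at h
  have e0 : φ 0 = X₀ ^ 4 / (Y₀ ^ 2 * Z₀ ^ 2) := by simp [hφ]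
  have e1 : φ 1 = X₁ ^ 4 / (Y₁ ^ 2 * Z₁ ^ 2) := by simp [hφ]
  rw [e0, e1] at h
  exact h

/-! ## The two-state mixture lemma (homogeneous coordinates) -/

/-- The quartic ratio in normalised coordinates equals the homogeneous one: `(Q/F)⁴/((A/F)²(B/F)²) = Q⁴/(A²B²)`. [folklore] -/
theorem ratio_div (Q A B F : ℝ) (hF : F ≠ 0) (hA : A ≠ 0) (hB : B ≠ 0) :
    (Q / F) ^ 4 / ((A / F) ^ 2 * (B / F) ^ 2) = Q ^ 4 / (A ^ 2 * B ^ 2) := by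
  field_simp

/-- Main case of the two-state mixture lemma: all of `A₀, B₀, A₁, B₁` positive. [this work] -/
theorem quartic_of_twoStates_pos {F₀ Q₀ A₀ B₀ C₀ F₁ Q₁ A₁ B₁ C₁ ρ : ℝ}
    (hQA0 : Q₀ ≤ A₀) (hQB0 : Q₀ ≤ B₀) (hs0 : A₀ + B₀ = F₀ + Q₀)
    (hQA1 : Q₁ ≤ A₁) (hQB1 : Q₁ ≤ B₁) (hs1 : A₁ + B₁ = F₁ + Q₁)
    (hV0 : Q₀ ^ 4 ≤ A₀ ^ 2 * B₀ ^ 2 * C₀) (hV1 : Q₁ ^ 4 ≤ A₁ ^ 2 * B₁ ^ 2 * C₁)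
    (hF : F₀ ≤ F₁) (hC : C₁ ≤ C₀) (hρ0 : 0 ≤ ρ) (hρ1 : ρ ≤ 1)
    (hA0p : 0 < A₀) (hB0p : 0 < B₀) (hA1p : 0 < A₁) (hB1p : 0 < B₁) (hF0p : 0 < F₀) (hF1p : 0 < F₁) :
    ((1 - ρ) * Q₀ + ρ * Q₁) ^ 4 ≤
      ((1 - ρ) * A₀ + ρ * A₁) ^ 2 * ((1 - ρ) * B₀ + ρ * B₁) ^ 2 * ((1 - ρ) * C₀ + ρ * C₁) := by
  have hρ1' : 0 ≤ 1 - ρ := sub_nonneg.2 hρ1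
  have hF0ne : F₀ ≠ 0 := hF0p.ne'
  have hF1ne : F₁ ≠ 0 := hF1p.ne'
  -- `V4` at the states in ratio form
  have r0 : Q₀ ^ 4 / (A₀ ^ 2 * B₀ ^ 2) ≤ C₀ := by rw [div_le_iff₀ (by positivity)]; linarith [hV0]
  have r1 : Q₁ ^ 4 / (A₁ ^ 2 * B₁ ^ 2) ≤ C₁ := by rw [div_le_iff₀ (by positivity)]; linarith [hV1]
  obtain ⟨G, hG⟩ : ∃ G : ℝ, G = (1 - ρ) * F₀ + ρ * F₁ := ⟨_, rfl⟩
  have hGp : 0 < G := by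
    rw [hG]; have h1 := mul_nonneg hρ0 (sub_nonneg.2 hF); linarith
  have hGne : G ≠ 0 := hGp.ne'
  have ht0 : 0 ≤ ρ * F₁ / G := by positivity
  have ht1 : ρ * F₁ / G ≤ 1 := by
    rw [div_le_one hGp, hG]; have := mul_nonneg hρ1' hF0p.le; linarith
  have htρ : ρ ≤ ρ * F₁ / G := by
    rw [le_div_iff₀ hGp, hG]
    have := mul_nonneg (mul_nonneg hρ0 hρ1') (sub_nonneg.2 hF)
    linarith
  have hAm : 0 < (1 - ρ) * A₀ + ρ * A₁ := by
    have h1 := mul_nonneg hρ1' (sub_nonneg.2 (min_le_left A₀ A₁))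
    have h2 := mul_nonneg hρ0 (sub_nonneg.2 (min_le_right A₀ A₁))
    have h3 := lt_min hA0p hA1p
    linarith
  have hBm : 0 < (1 - ρ) * B₀ + ρ * B₁ := by
    have h1 := mul_nonneg hρ1' (sub_nonneg.2 (min_le_left B₀ B₁))
    have h2 := mul_nonneg hρ0 (sub_nonneg.2 (min_le_right B₀ B₁))
    have h3 := lt_min hB0p hB1p
    linarith
  -- identify the mixture point (normalised coordinates, tilted weight `t = ρF₁/G`)
  have eQ0 : Q₀ = A₀ + B₀ - F₀ := by linarith
  have eQ1 : Q₁ = A₁ + B₁ - F₁ := by linarith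
  have hdef : Q₁ / F₁ - Q₀ / F₀ = (A₁ / F₁ - A₀ / F₀) + (B₁ / F₁ - B₀ / F₀) := by
    rw [eQ0, eQ1]; field_simp; ring
  have emix : ∀ X₀ X₁ : ℝ, X₀ / F₀ + ρ * F₁ / G * (X₁ / F₁ - X₀ / F₀) = ((1 - ρ) * X₀ + ρ * X₁) / G := by
    intro X₀ X₁
    field_simp
    rw [hG]
    ring
  have eQ := emix Q₀ Q₁
  have eA := emix A₀ A₁
  have eB := emix B₀ B₁
  -- the chord inequality in normalised coordinates
  have hch := chord_le (Q₀ / F₀) (A₀ / F₀) (B₀ / F₀) (Q₁ / F₁) (A₁ / F₁) (B₁ / F₁)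
    (div_le_div_of_nonneg_right hQA0 hF0p.le) (div_le_div_of_nonneg_right hQB0 hF0p.le)
    (div_le_div_of_nonneg_right hQA1 hF1p.le) (div_le_div_of_nonneg_right hQB1 hF1p.le)
    (div_pos hA0p hF0p) (div_pos hB0p hF0p) (div_pos hA1p hF1p) (div_pos hB1p hF1p)
    hdef ht0 ht1
  rw [eQ, eA, eB, ratio_div _ _ _ _ hGne hAm.ne' hBm.ne', ratio_div _ _ _ _ hF0ne hA0p.ne' hB0p.ne',
    ratio_div _ _ _ _ hF1ne hA1p.ne' hB1p.ne'] at hch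
  have step : (1 - ρ * F₁ / G) * (Q₀ ^ 4 / (A₀ ^ 2 * B₀ ^ 2)) + ρ * F₁ / G * (Q₁ ^ 4 / (A₁ ^ 2 * B₁ ^ 2)) ≤
      (1 - ρ) * C₀ + ρ * C₁ := by
    have h1 : (1 - ρ * F₁ / G) * (Q₀ ^ 4 / (A₀ ^ 2 * B₀ ^ 2)) ≤ (1 - ρ * F₁ / G) * C₀ :=
      mul_le_mul_of_nonneg_left r0 (sub_nonneg.2 ht1)
    have h2 : ρ * F₁ / G * (Q₁ ^ 4 / (A₁ ^ 2 * B₁ ^ 2)) ≤ ρ * F₁ / G * C₁ := mul_le_mul_of_nonneg_left r1 ht0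
    have h3 := mul_le_mul_of_nonneg_right htρ (sub_nonneg.2 hC)
    linarith [h1, h2, h3]
  have key := le_trans hch step
  rw [div_le_iff₀ (by positivity)] at key
  linarith [key]

/-- **Two-state mixture lemma for `V4` (F-monotone case).**  Two states `(Fₖ, Qₖ, Aₖ, Bₖ, Cₖ)` with the port structure
`0 ≤ Qₖ ≤ Aₖ, Bₖ`, `Aₖ + Bₖ = Fₖ + Qₖ`, `0 ≤ Cₖ`, each satisfying `V4ₖ : Qₖ⁴ ≤ Aₖ²Bₖ²Cₖ`, with `F₀ ≤ F₁` and `C₁ ≤ C₀`;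
then the `ρ`-mixture satisfies `V4`.  Proof: in normal form the mixture point is the `F`-tilted combination (weight `t = ρF₁/F̄ ≥ ρ`) of the
two normalised points, `chord_le` bounds the quartic ratio there by `(1−t)·Q₀⁴/(A₀²B₀²) + t·Q₁⁴/(A₁²B₁²) ≤ (1−t)C₀ + tC₁ ≤ (1−ρ)C₀ + ρC₁`;
degenerate states (`AₖBₖ = 0`, forcing `Qₖ = 0`) are elementary. [this work] -/
theorem quartic_of_twoStates {F₀ Q₀ A₀ B₀ C₀ F₁ Q₁ A₁ B₁ C₁ ρ : ℝ}
    (hQ0 : 0 ≤ Q₀) (hQA0 : Q₀ ≤ A₀) (hQB0 : Q₀ ≤ B₀) (hs0 : A₀ + B₀ = F₀ + Q₀) (hC0 : 0 ≤ C₀)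
    (hQ1 : 0 ≤ Q₁) (hQA1 : Q₁ ≤ A₁) (hQB1 : Q₁ ≤ B₁) (hs1 : A₁ + B₁ = F₁ + Q₁) (hC1 : 0 ≤ C₁)
    (hV0 : Q₀ ^ 4 ≤ A₀ ^ 2 * B₀ ^ 2 * C₀) (hV1 : Q₁ ^ 4 ≤ A₁ ^ 2 * B₁ ^ 2 * C₁)
    (hF : F₀ ≤ F₁) (hC : C₁ ≤ C₀) (hρ0 : 0 ≤ ρ) (hρ1 : ρ ≤ 1) :
    ((1 - ρ) * Q₀ + ρ * Q₁) ^ 4 ≤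
      ((1 - ρ) * A₀ + ρ * A₁) ^ 2 * ((1 - ρ) * B₀ + ρ * B₁) ^ 2 * ((1 - ρ) * C₀ + ρ * C₁) := by
  have hA0F : A₀ ≤ F₀ := by linarith
  have hB0F : B₀ ≤ F₀ := by linarith
  have hA1F : A₁ ≤ F₁ := by linarith
  have hB1F : B₁ ≤ F₁ := by linarith
  have hA0 : 0 ≤ A₀ := le_trans hQ0 hQA0
  have hB0 : 0 ≤ B₀ := le_trans hQ0 hQB0
  have hA1 : 0 ≤ A₁ := le_trans hQ1 hQA1
  have hB1 : 0 ≤ B₁ := le_trans hQ1 hQB1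
  have hρ1' : 0 ≤ 1 - ρ := sub_nonneg.2 hρ1
  have hAm0 : (1 - ρ) * A₀ ≤ (1 - ρ) * A₀ + ρ * A₁ := by have := mul_nonneg hρ0 hA1; linarith
  have hBm0 : (1 - ρ) * B₀ ≤ (1 - ρ) * B₀ + ρ * B₁ := by have := mul_nonneg hρ0 hB1; linarith
  have hAm1 : ρ * A₁ ≤ (1 - ρ) * A₀ + ρ * A₁ := by have := mul_nonneg hρ1' hA0; linarith
  have hBm1 : ρ * B₁ ≤ (1 - ρ) * B₀ + ρ * B₁ := by have := mul_nonneg hρ1' hB0; linarith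
  have hCm0 : (1 - ρ) * C₀ ≤ (1 - ρ) * C₀ + ρ * C₁ := by have := mul_nonneg hρ0 hC1; linarith
  have hCm1 : C₁ ≤ (1 - ρ) * C₀ + ρ * C₁ := by have := mul_le_mul_of_nonneg_left hC hρ1'; linarith
  by_cases hdeg0 : A₀ * B₀ = 0
  · have hQ00 : Q₀ = 0 := by
      rcases mul_eq_zero.1 hdeg0 with h | h <;> linarith
    have h1 : ((1 - ρ) * Q₀ + ρ * Q₁) ^ 4 = ρ ^ 4 * Q₁ ^ 4 := by rw [hQ00]; ring
    rw [h1]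
    rcases mul_eq_zero.1 hdeg0 with hA00 | hB00
    · have hAeq : (1 - ρ) * A₀ + ρ * A₁ = ρ * A₁ := by rw [hA00]; ring
      rw [hAeq]
      calc ρ ^ 4 * Q₁ ^ 4 ≤ ρ ^ 4 * (A₁ ^ 2 * B₁ ^ 2 * C₁) := by gcongr
        _ = (ρ * A₁) ^ 2 * (ρ * B₁) ^ 2 * C₁ := by ring
        _ ≤ (ρ * A₁) ^ 2 * ((1 - ρ) * B₀ + ρ * B₁) ^ 2 * ((1 - ρ) * C₀ + ρ * C₁) := by gcongr
    · have hBeq : (1 - ρ) * B₀ + ρ * B₁ = ρ * B₁ := by rw [hB00]; ring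
      rw [hBeq]
      calc ρ ^ 4 * Q₁ ^ 4 ≤ ρ ^ 4 * (A₁ ^ 2 * B₁ ^ 2 * C₁) := by gcongr
        _ = (ρ * A₁) ^ 2 * (ρ * B₁) ^ 2 * C₁ := by ring
        _ ≤ ((1 - ρ) * A₀ + ρ * A₁) ^ 2 * (ρ * B₁) ^ 2 * ((1 - ρ) * C₀ + ρ * C₁) := by gcongr
  by_cases hdeg1 : A₁ * B₁ = 0
  · have hQ10 : Q₁ = 0 := by
      rcases mul_eq_zero.1 hdeg1 with h | h <;> linarith
    have h1 : ((1 - ρ) * Q₀ + ρ * Q₁) ^ 4 = (1 - ρ) ^ 4 * Q₀ ^ 4 := by rw [hQ10]; ring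
    rw [h1]
    rcases mul_eq_zero.1 hdeg1 with hA10 | hB10
    · have hBmB0 : B₀ ≤ (1 - ρ) * B₀ + ρ * B₁ := by
        have := mul_le_mul_of_nonneg_left (show B₀ ≤ B₁ by linarith) hρ0; linarith
      calc (1 - ρ) ^ 4 * Q₀ ^ 4 ≤ (1 - ρ) ^ 4 * (A₀ ^ 2 * B₀ ^ 2 * C₀) := by gcongr
        _ = ((1 - ρ) * A₀) ^ 2 * (((1 - ρ) * B₀) * B₀) * ((1 - ρ) * C₀) := by ring
        _ ≤ ((1 - ρ) * A₀ + ρ * A₁) ^ 2 * ((((1 - ρ) * B₀ + ρ * B₁)) * ((1 - ρ) * B₀ + ρ * B₁)) * ((1 - ρ) * C₀ + ρ * C₁) := by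
          gcongr
        _ = _ := by ring
    · have hAmA0 : A₀ ≤ (1 - ρ) * A₀ + ρ * A₁ := by
        have := mul_le_mul_of_nonneg_left (show A₀ ≤ A₁ by linarith) hρ0; linarith
      calc (1 - ρ) ^ 4 * Q₀ ^ 4 ≤ (1 - ρ) ^ 4 * (A₀ ^ 2 * B₀ ^ 2 * C₀) := by gcongr
        _ = (((1 - ρ) * A₀) * A₀) * ((1 - ρ) * B₀) ^ 2 * ((1 - ρ) * C₀) := by ring
        _ ≤ (((1 - ρ) * A₀ + ρ * A₁) * ((1 - ρ) * A₀ + ρ * A₁)) * ((1 - ρ) * B₀ + ρ * B₁) ^ 2 * ((1 - ρ) * C₀ + ρ * C₁) := by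
          gcongr
        _ = _ := by ring
  -- main case
  have hA0p : 0 < A₀ := lt_of_le_of_ne hA0 (fun h => hdeg0 (by rw [← h]; ring))
  have hB0p : 0 < B₀ := lt_of_le_of_ne hB0 (fun h => hdeg0 (by rw [← h]; ring))
  have hA1p : 0 < A₁ := lt_of_le_of_ne hA1 (fun h => hdeg1 (by rw [← h]; ring))
  have hB1p : 0 < B₁ := lt_of_le_of_ne hB1 (fun h => hdeg1 (by rw [← h]; ring))
  exact quartic_of_twoStates_pos hQA0 hQB0 hs0 hQA1 hQB1 hs1 hV0 hV1 hF hC hρ0 hρ1 hA0p hB0p hA1p hB1p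
    (lt_of_lt_of_le hA0p hA0F) (lt_of_lt_of_le hA1p hA1F)

end Summit.CriticalPhenomena.PercolationContinuityZ3.Theorems.SuperTerminalQuarticChord
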